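import Summits.QuantumAdvantage.QuantumAdvantage.Theorems.SparsityDialMP8

/-!
# SparsityDial — part MP9 of 10 of the «MovingPointers» package (decomp-qadv lens 2, g18): §D3–§D5 affine-lookup loss `AffineLookupLoss3` (PROVED, no position constraints) + S-form

Imports its predecessor `SparsityDialMP8` (linear chain MP1 → … → MP10); the package overview is the module docstring of `SparsityDialMP1`.
No `sorry`; standard axioms; no instances / notation.
-/

set_option linter.unusedVariables false
set_option linter.dupNamespace false

noncomputable section
open scoped Classical

namespace Summit.QuantumAdvantage.QuantumAdvantage.Theorems.SparsityDial

open Finset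
open Literature.Computability.QuantumComplexity Literature.Computability.QuantumComplexity.RingHLF
open Literature.Computability.MetaComplexity Literature.Computability.MetaComplexity.Smolensky
open Summit.QuantumAdvantage.AdviceFreeQNC0
open Summit.QuantumAdvantage.QuantumAdvantage.Theorems.HolonomyDial (gCond)
open Summit.QuantumAdvantage.QuantumAdvantage.Theorems.LocusDial
open Summit.QuantumAdvantage.QuantumAdvantage.Theorems.AnchorDial (dev outB win_iff card_odd_ge)
open Summit.QuantumAdvantage.QuantumAdvantage.Theorems.HolonomyDial (card_odd_le)
open Summit.QuantumAdvantage.QuantumAdvantage.Theorems.StabilizerDial (eventually_polylog StabFew stabFew_of_fewLocus)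

/-! ## §D3  Counting the losers with a free window: fibre by fibre, then globally -/

section DirCount
variable {N t : ℕ}

/-- SparsityDial «MovingPointers» helper `fibre_losers_dir_ge` (decomp-qadv lens-2 g18 land package; see the module docstring). -/
theorem fibre_losers_dir_ge (M : Fin t → Fin N → ZMod 3) (v : Fin t → ZMod 3) {m : ℕ} (k : Fin m → ℕ)
    (s : Fin m → ZMod 3) (hs : ∀ l, s l ≠ 0) (B : ℝ) (hB0 : 0 ≤ B)
    (hB : ∀ α a : Fin m → ZMod 3, (∑ l, s l * α l) ≠ 0 → ‖fibSumM M v α a k‖ ≤ B) :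
    ((fib M v).card : ℝ) ≤
      3 * ((fib M v).filter (fun x =>
        Even ((univ : Finset (Fin m)).filter (fun l => kph x (k l) ≠ 2)).card)).card + 3 ^ (m + 1) * B := by
  set cell : (Fin m → ZMod 3) → ℝ := fun a => (((fib M v).filter (fun x => ∀ l, kph x (k l) = a l)).card : ℝ)
    with hcell
  set Lf := (fib M v).filter (fun x =>
        Even ((univ : Finset (Fin m)).filter (fun l => kph x (k l) ≠ 2)).card) with hLf
  set E := evenCells m with hEdef
  have htot : ((fib M v).card : ℝ) = ∑ b : Fin m → ZMod 3, cell b := by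
    have h := card_eq_sum_card_fiberwise (f := fun x => (fun l => kph x (k l))) (s := fib M v)
      (t := (univ : Finset (Fin m → ZMod 3))) (fun x _ => mem_univ _)
    rw [h]
    push_cast
    apply sum_congr rfl
    intro b _
    simp only [hcell]
    congr 2
    ext x
    simp only [mem_filter]
    constructor
    · rintro ⟨hx, hfx⟩
      exact ⟨hx, fun l => congrFun hfx l⟩
    · rintro ⟨hx, hl⟩
      exact ⟨hx, funext hl⟩
  have hfib : Lf.card = ∑ a ∈ E, ((fib M v).filter (fun x => ∀ l, kph x (k l) = a l)).card := by
    rw [card_eq_sum_card_fiberwise (f := fun x => (fun l => kph x (k l))) (s := Lf) (t := E) ?_]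
    · apply sum_congr rfl
      intro a ha
      have ha' : Even ((univ : Finset (Fin m)).filter (fun l => a l ≠ 2)).card := by
        rw [hEdef] at ha; unfold evenCells at ha; rw [mem_filter] at ha; exact ha.2
      congr 1
      ext x
      simp only [hLf, mem_filter]
      constructor
      · rintro ⟨⟨hx, _⟩, hfx⟩
        exact ⟨hx, fun l => congrFun hfx l⟩
      · rintro ⟨hx, hl⟩
        have hfx : (fun l => kph x (k l)) = a := funext hl
        refine ⟨⟨hx, ?_⟩, hfx⟩
        have hset : (univ : Finset (Fin m)).filter (fun l => kph x (k l) ≠ 2) =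
            (univ : Finset (Fin m)).filter (fun l => a l ≠ 2) :=
          filter_congr (fun l _ => by rw [hl l])
        rw [hset]; exact ha'
    · intro x hx
      rw [hLf, coe_filter] at hx
      rw [hEdef]
      unfold evenCells
      rw [coe_filter]
      exact ⟨mem_univ _, hx.2⟩
  have hLfR : (Lf.card : ℝ) = ∑ a ∈ E, cell a := by
    rw [hfib]; push_cast; rfl
  have hline : ∀ a : Fin m → ZMod 3, ∑ γ : ZMod 3, cell (fun l => a l - γ * s l) ≤ 3 * cell a + 3 * B :=
    fun a => line_le_cell_dir M v s a k B hB0 (fun α hα => hB α a hα)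
  have hcov : ∑ b : Fin m → ZMod 3, cell b ≤ ∑ a ∈ E, ∑ γ : ZMod 3, cell (fun l => a l - γ * s l) := by
    rw [hEdef]
    exact cover_sum_le_dir s hs cell (fun b => by simp only [hcell]; positivity)
  have hsum := sum_le_sum (fun a (_ : a ∈ E) => hline a)
  rw [sum_add_distrib, ← mul_sum, sum_const, nsmul_eq_mul] at hsum
  have hEle : (E.card : ℝ) ≤ 3 ^ m := by
    have h1 : E.card ≤ (univ : Finset (Fin m → ZMod 3)).card := by
      rw [hEdef]; unfold evenCells; exact card_filter_le _ _
    rw [card_univ, Fintype.card_fun, ZMod.card, Fintype.card_fin] at h1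
    exact_mod_cast h1
  rw [htot, hLfR, pow_succ]
  nlinarith [hcov, hsum, hEle, hB0]

/-- **global count with free windows**: `#odd ≤ 3·#{odd : EVEN number of good deviations} + 2^N/144`. -/
theorem dir_losers_ge (M : Fin t → Fin N → ZMod 3) {m : ℕ} (π : (Fin t → ZMod 3) → Fin m → ℕ) (j : ℕ)
    (hwin : ∀ v, ∃ w, w + 2 * j + 1 ≤ N ∧ ∀ l, π v l ≤ w ∨ w + 2 * j ≤ π v l)
    (hjt : 8 * (t + m + 3) + 20 ≤ j) :
    ((univ.filter fun x : Fin N → Bool => OddZeros x).card : ℝ) ≤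
      3 * ((univ.filter fun x : Fin N → Bool => OddZeros x ∧
        Even ((univ : Finset (Fin m)).filter (fun l => kph x (π (linHash M x) l) ≠ 2)).card).card : ℝ) +
        2 ^ N / 144 := by
  set Odd := (univ : Finset (Fin N → Bool)).filter (fun x => OddZeros x) with hOdd
  set L := univ.filter fun x : Fin N → Bool => OddZeros x ∧
        Even ((univ : Finset (Fin m)).filter (fun l => kph x (π (linHash M x) l) ≠ 2)).card with hL
  have hOdd_fib : Odd.card = ∑ v : Fin t → ZMod 3, (fib M v).card := by
    rw [card_eq_sum_card_fiberwise (f := fun x => linHash M x) (t := (univ : Finset (Fin t → ZMod 3)))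
      (fun x _ => mem_univ _)]
    rfl
  have hL_fib : L.card = ∑ v : Fin t → ZMod 3, ((fib M v).filter (fun x =>
      Even ((univ : Finset (Fin m)).filter (fun l => kph x (π v l) ≠ 2)).card)).card := by
    rw [card_eq_sum_card_fiberwise (f := fun x => linHash M x) (t := (univ : Finset (Fin t → ZMod 3)))
      (fun x _ => mem_univ _)]
    apply sum_congr rfl
    intro v _
    congr 1
    rw [hL]
    unfold fib
    ext x
    simp only [mem_filter, mem_univ, true_and]
    constructor
    · rintro ⟨⟨hx, hk⟩, hv⟩
      exact ⟨⟨hx, hv⟩, by rw [← hv]; exact hk⟩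
    · rintro ⟨⟨hx, hv⟩, hk⟩
      exact ⟨⟨hx, by rw [hv]; exact hk⟩, hv⟩
  have hfib : ∀ v : Fin t → ZMod 3, ((fib M v).card : ℝ) ≤
      3 * ((fib M v).filter (fun x =>
        Even ((univ : Finset (Fin m)).filter (fun l => kph x (π v l) ≠ 2)).card)).card +
        3 ^ (m + 1) * (2 ^ N / (432 * 3 ^ m * 3 ^ t)) := by
    intro v
    obtain ⟨w, hwN, hwl⟩ := hwin v
    apply fibre_losers_dir_ge M v (π v) (dirVec (π v) w j) (dirVec_ne_zero (π v) w j)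
      (2 ^ N / (432 * 3 ^ m * 3 ^ t)) (by positivity)
    intro α a hα
    have hb := fibSumM_bound_window M v α a (π v) w j hα hwl hwN hjt
    rw [le_div_iff₀ (by positivity)]
    linarith
  have hs := sum_le_sum (fun v (_ : v ∈ (univ : Finset (Fin t → ZMod 3))) => hfib v)
  rw [sum_add_distrib, ← mul_sum, sum_const, card_univ, Fintype.card_fun, ZMod.card, Fintype.card_fin,
    nsmul_eq_mul] at hs
  push_cast at hs
  have e : (3 : ℝ) ^ t * (3 ^ (m + 1) * (2 ^ N / (432 * 3 ^ m * 3 ^ t))) = 2 ^ N / 144 := by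
    rw [pow_succ]
    field_simp
    ring
  rw [hOdd_fib, hL_fib]
  push_cast
  linarith

end DirCount

/-! ## §D4  THE AFFINE-LOOKUP LOSS THEOREM (no position constraints at all) and the rung `AffineLookupLoss3` (PROVED) -/

section LookupStrategy
variable {N t : ℕ}

/-- **THE AFFINE-LOOKUP LOSS THEOREM**: deviation set = the image of ANY injective `m`-tuple of positions looked up from
an `𝔽₃`-linear hash with `t` forms; if every fibre's configuration leaves a window of `2j` steps free (automatic when
`(m+1)·2j + 1 ≤ N`, `exists_free_window`) and `8(t+m+3) + 20 ≤ j`, then `#odd ≤ 4·#{odd losers}`. -/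
theorem lookup_loss (hN : 3 ≤ N) (M : Fin t → Fin N → ZMod 3) {m : ℕ} (π : (Fin t → ZMod 3) → Fin m → Fin N)
    (j : ℕ) (hinj : ∀ v, Function.Injective (π v))
    (hwin : ∀ v, ∃ w, w + 2 * j + 1 ≤ N ∧ ∀ l, (π v l).val ≤ w ∨ w + 2 * j ≤ (π v l).val)
    (hjt : 8 * (t + m + 3) + 20 ≤ j) (P : Fin N → CubeFn (ZMod 3) N)
    (hdev : ∀ x, OddZeros x → dev P x = univ.image (π (linHash M x))) :
    (univ.filter fun x : Fin N → Bool => OddZeros x).card ≤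
      4 * (univ.filter fun x : Fin N → Bool => OddZeros x ∧ ¬ Rel x (outB P x)).card := by
  have hlos : (univ.filter fun x : Fin N → Bool => OddZeros x ∧ ¬ Rel x (outB P x)) =
      univ.filter fun x : Fin N → Bool => OddZeros x ∧
        Even ((univ : Finset (Fin m)).filter (fun l => kph x (π (linHash M x) l).val ≠ 2)).card := by
    apply filter_congr
    intro x _
    exact and_congr_right (fun hx => lose_iff_of_dev_image hN P x hx _ (hinj _) (hdev x hx))
  rw [hlos]
  have h5 := dir_losers_ge M (fun v l => (π v l).val) j hwin hjt
  set O := (univ.filter fun x : Fin N → Bool => OddZeros x).card with hO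
  set L := (univ.filter fun x : Fin N → Bool => OddZeros x ∧
        Even ((univ : Finset (Fin m)).filter (fun l => kph x (π (linHash M x) l).val ≠ 2)).card).card with hL
  have hOge : 2 ^ (N - 1) ≤ O := card_odd_ge (by omega)
  have hOge' : (2 : ℝ) ^ (N - 1) ≤ O := by exact_mod_cast hOge
  have hpow : (2 : ℝ) ^ N = 2 * 2 ^ (N - 1) := by
    rw [← pow_succ']; congr 1; omega
  have h5' : (O : ℝ) ≤ 3 * (L : ℝ) + 2 ^ N / 144 := h5
  have hreal : (O : ℝ) ≤ 4 * L := by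
    rw [hpow] at h5'
    nlinarith [h5', hOge']
  exact_mod_cast hreal

/-- **the rung `AffineLookupLoss3`**: every strategy whose deviation set at each odd input is the image of an INJECTIVE
tuple of `m ≤ (log₂ n)^c` positions — ANY positions — looked up by arbitrary functions from an `𝔽₃`-linear hash of the
input with `t ≤ (log₂ n)^c` forms wins on at most `(1 − n^{-C})·2^{n−1}` odd inputs. -/
def AffineLookupLoss3 : Prop := ∃ C : ℕ, ∀ c : ℕ, ∃ n₀ : ℕ, ∀ n ≥ n₀, ∀ t ≤ (Nat.log 2 n) ^ c,
  ∀ m ≤ (Nat.log 2 n) ^ c, ∀ (M : Fin t → Fin n → ZMod 3) (π : (Fin t → ZMod 3) → Fin m → Fin n),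
    (∀ v, Function.Injective (π v)) →
    ∀ P : Fin n → CubeFn (ZMod 3) n, (∀ x, OddZeros x → dev P x = univ.image (π (linHash M x))) →
      ((univ.filter fun x : Fin n → Bool => OddZeros x ∧ Rel x (fun i => decide (P i x = 1))).card : ℝ) ≤
        (1 - 1 / (n : ℝ) ^ C) * (2 : ℝ) ^ (n - 1)

/-- **`AffineLookupLoss3` PROVED** (`C = 1`; `j = ⌊n / (8((log₂ n)^c + 1))⌋`, free window by pigeonhole). -/
theorem affineLookupLoss3 : AffineLookupLoss3 := by
  refine ⟨1, fun c => ?_⟩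
  obtain ⟨n₀, hn₀⟩ := eventually_polylog 1920 (2 * c)
  refine ⟨n₀, fun n hn t ht m hmle M π hinj P hdev => ?_⟩
  obtain ⟨hK, hL⟩ := hn₀ n hn
  set A := (Nat.log 2 n) ^ c with hA
  have hA1 : 1 ≤ A := Nat.one_le_pow _ _ (by omega)
  have hA2 : (Nat.log 2 n) ^ (2 * c) = A * A := by rw [hA, ← pow_add]; ring_nf
  rw [hA2] at hK
  have hn2 : 1920 * (A * A) ≤ n := le_trans hK (Nat.div_le_self n 2)
  have h4 : 4 ≤ n := by nlinarith
  have h3 : 3 ≤ n := by omega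
  set d := n / (4 * (A + 1)) with hd
  have hdA : d * (4 * (A + 1)) ≤ n := Nat.div_mul_le_self n (4 * (A + 1))
  have hdge : 32 * A + 88 ≤ d := by
    rw [hd, Nat.le_div_iff_mul_le (by omega)]
    nlinarith
  set j := d / 2 with hj
  have hjt : 8 * (t + m + 3) + 20 ≤ j := by omega
  have hj1 : 1 ≤ j := by omega
  have h2jd : 2 * j ≤ d := by omega
  have hw1 : (m + 1) * (2 * j) ≤ (A + 1) * d := Nat.mul_le_mul (by omega) h2jd
  have hw2 : (A + 1) * d * 4 ≤ n := by
    have e : (A + 1) * d * 4 = d * (4 * (A + 1)) := by ring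
    rw [e]; exact hdA
  have hwN : (m + 1) * (2 * j) + 1 ≤ n := by omega
  have hwin : ∀ v, ∃ w, w + 2 * j + 1 ≤ n ∧ ∀ l, (π v l).val ≤ w ∨ w + 2 * j ≤ (π v l).val :=
    fun v => exists_free_window (fun l => (π v l).val) j hj1 hwN
  have hq := lookup_loss (N := n) h3 M π j hinj hwin hjt P hdev
  exact real_loss_of_frac (M := 4) (by norm_num) (by omega) h3 P hq

/-- REV 5 ladder by name: `AffineLookupLoss3 → AffinePointersLoss3` (drop the position hypothesis). -/
theorem any_of_lookup (h : AffineLookupLoss3) : AffinePointersLoss3 := by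
  obtain ⟨C, hC⟩ := h
  refine ⟨C, fun c => ?_⟩
  obtain ⟨n₀, hn₀⟩ := hC c
  exact ⟨n₀, fun n hn t ht m hm M π hinj _ P hdev => hn₀ n hn t ht m hm M π hinj P hdev⟩

end LookupStrategy

/-! ## §D5  The S-restricted statement: LITERALLY below piece S, and PROVED — S DECIDED ON THE WHOLE AFFINE-LOOKUP CLASS -/

section LookupSRung
variable {N t : ℕ}

/-- **`AffineLookupLossS3`** — the affine-lookup family under piece S's own hypotheses (low degree, no cheap ONE-point
normal form), in the `∀ c, ∃ C` order (a consequence of `SparseGenericLoss3` at scale `a := c` by name). -/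
def AffineLookupLossS3 : Prop := ∀ c : ℕ, ∃ C : ℕ, ∃ n₀ : ℕ, ∀ n ≥ n₀, ∀ t ≤ (Nat.log 2 n) ^ c,
  ∀ m ≤ (Nat.log 2 n) ^ c, ∀ (M : Fin t → Fin n → ZMod 3) (π : (Fin t → ZMod 3) → Fin m → Fin n),
    (∀ v, Function.Injective (π v)) →
    ∀ P : Fin n → CubeFn (ZMod 3) n, (∀ i, P i ∈ lowDeg (ZMod 3) n ((Nat.log 2 n) ^ c)) →
      ¬ StabFew 1 0 (c + 1) P →
      (∀ x, OddZeros x → dev P x = univ.image (π (linHash M x))) →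
      ((univ.filter fun x : Fin n → Bool => OddZeros x ∧ Rel x (fun i => decide (P i x = 1))).card : ℝ) ≤
        (1 - 1 / (n : ℝ) ^ C) * (2 : ℝ) ^ (n - 1)

/-- BY NAME: piece S (landed `Theorems.SparsityDial.SparseGenericLoss3`) implies the S-restricted affine-lookup statement. -/
theorem lookupS_of_sparse (hS : SparseGenericLoss3) : AffineLookupLossS3 := by
  intro c
  obtain ⟨C, hC⟩ := hS c
  obtain ⟨n₀, hn₀⟩ := hC c
  refine ⟨C, n₀, fun n hn t ht m hm M π h1 P hdeg hnot hdev => ?_⟩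
  exact hn₀ n hn P hdeg (stabFew_of_fewLocus (c + 1) (fewLocus_of_dev_image M hm π P hdev)) hnot


/-- SparsityDial «MovingPointers» helper `lookupS_of_lookup` (decomp-qadv lens-2 g18 land package; see the module docstring). -/
theorem lookupS_of_lookup (h : AffineLookupLoss3) : AffineLookupLossS3 := by
  obtain ⟨C, hC⟩ := h
  intro c
  obtain ⟨n₀, hn₀⟩ := hC c
  exact ⟨C, n₀, fun n hn t ht m hm M π h1 P _ _ hdev => hn₀ n hn t ht m hm M π h1 P hdev⟩

/-- **S DECIDED on the whole AFFINE-LOOKUP sub-class: `AffineLookupLossS3` PROVED.** -/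
theorem affineLookupLossS3 : AffineLookupLossS3 := lookupS_of_lookup affineLookupLoss3

end LookupSRung

/-- info: 'Summit.QuantumAdvantage.QuantumAdvantage.Theorems.SparsityDial.lookup_loss' depends on axioms: [propext,
 Classical.choice,
 Quot.sound] -/
#guard_msgs in #print axioms lookup_loss
/-- info: 'Summit.QuantumAdvantage.QuantumAdvantage.Theorems.SparsityDial.affineLookupLoss3' depends on axioms: [propext,
 Classical.choice,
 Quot.sound] -/
#guard_msgs in #print axioms affineLookupLoss3
/-- info: 'Summit.QuantumAdvantage.QuantumAdvantage.Theorems.SparsityDial.affineLookupLossS3' depends on axioms: [propext,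
 Classical.choice,
 Quot.sound] -/
#guard_msgs in #print axioms affineLookupLossS3
/-- info: 'Summit.QuantumAdvantage.QuantumAdvantage.Theorems.SparsityDial.exists_shift_even_dir' depends on axioms: [propext,
 Classical.choice,
 Quot.sound] -/
#guard_msgs in #print axioms exists_shift_even_dir
/-- info: 'Summit.QuantumAdvantage.QuantumAdvantage.Theorems.SparsityDial.exists_free_window' depends on axioms: [propext,
 Classical.choice,
 Quot.sound] -/
#guard_msgs in #print axioms exists_free_window
/-- info: 'Summit.QuantumAdvantage.QuantumAdvantage.Theorems.SparsityDial.any_of_lookup' depends on axioms: [propext,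
 Classical.choice,
 Quot.sound] -/
#guard_msgs in #print axioms any_of_lookup


end Summit.QuantumAdvantage.QuantumAdvantage.Theorems.SparsityDial
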